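import Literature.RepresentationTheory.Kovacevic2021.SU21ModulesFromKTypes
import HarnessLib

/-!
# Unitarizability of Kovačević's `K`-type data for `SU(2,1)`: the notion, the standard Hermitian form,
# and the trivial module

Continuation of `Literature.RepresentationTheory.Kovacevic2021.SU21ModulesFromKTypes` (a datum `𝒟 : SU21Datum`
carries the `𝔤𝔩(3,ℂ)`-module `𝒟.V` with basis `u^k_{n,m}`).

[Kovacevic2021, §4 Thm 4] decides which of the modules of Thm 3 / Thm 5 are unitary by exhibiting an invariant
Hermitian form; [BorelWallach2000, VI Thm 4.12 (2)] (Kraljević) records that the cohomological `J_{ij}` are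
unitary.  For the real form `𝔰𝔲(2,1) = {X ∈ 𝔰𝔩(3,ℂ) : X^* J = -J X}`, `J = diag(1,1,-1)`, a representation on a
complex vector space with a positive definite Hermitian form `B` is unitary iff `𝔰𝔲(2,1)` acts by skew-adjoint
operators; complexified to `𝔤𝔩(3,ℂ)` (centre acting by `0`) this reads, on the matrix units,
`B(E_{ij} v, w) = ε_i ε_j B(v, E_{ji} w)` with `ε = (1, 1, -1)` (`E_{ij}^† = ε_i ε_j E_{ji}` for the form of
signature `(2,1)`).  This file fixes that notion for a datum (`IsUnitarizable`, a DEFINITION with body), constructs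
the standard Hermitian form `⟨v, w⟩ = Σ_t conj(v_t) w_t` in the basis `u^k_{n,m}` (`stdForm`; positive definite,
Hermitian), and proves the first instance: the trivial module `U(0) = J_{0,0}` is unitarizable (all of `𝔤𝔩(3,ℂ)`
acts by `0` on it).  The remaining five cohomological modules need weighted forms (the weights solve
Kovačević's recursions (b20)–(b45) with signs, Thm 4) and are NOT treated here.

## References

* D. Kovačević, *Unitary `(𝔤,K)` modules of `SU(2,1)`*, Acta Math. Spalatensia 1 (2021) 105–125
  (arXiv:1810.01752): §2 (the form of signature `(2,1)`), §4 Thm 4. [Kovacevic2021]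
* A. Borel, N. Wallach (2000), VI Thm 4.12 (2) p. 133. [BorelWallach2000]
-/

noncomputable section

open Finsupp

namespace Literature.RepresentationTheory.Kovacevic2021

-- Mathlib idiom (Mathlib/Algebra/Lie/OfAssociative.lean): commutator brackets on associative algebras; needed for
-- the `𝔤𝔩(3,ℂ)`-module structure on `𝒟.V`, as in every file of this directory.
attribute [local instance 100] LieRing.ofAssociativeRing

namespace SU21Datum

/-- the signs `ε = (1, 1, -1)` of the Hermitian form of signature `(2,1)` defining `SU(2,1)`
[cite: Kovacevic2021, §2] -/
def suSign (i : Fin 3) : ℂ := if i = 2 then -1 else 1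

/-- **Unitarizability** of the `𝔤𝔩(3,ℂ)`-module of a datum for the real form `𝔰𝔲(2,1)`: a positive definite
Hermitian form `B` on `V` (conjugate-linear in the first variable) with `B(E_{ij} v, w) = ε_i ε_j B(v, E_{ji} w)`,
i.e. `𝔰𝔲(2,1)` acts by skew-adjoint operators. [cite: Kovacevic2021, §4 Thm 4] [cite: BorelWallach2000, VI Thm 4.12] -/
def IsUnitarizable (𝒟 : SU21Datum) : Prop :=
  ∃ B : 𝒟.V →ₗ⋆[ℂ] 𝒟.V →ₗ[ℂ] ℂ, (∀ v w, B v w = starRingEnd ℂ (B w v)) ∧ (∀ v, v ≠ 0 → 0 < (B v v).re) ∧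
    ∀ (i j : Fin 3) (v w : 𝒟.V), B ⁅E i j, v⁆ w = suSign i * suSign j * B v ⁅E j i, w⁆

variable (𝒟 : SU21Datum)

/-- **The standard Hermitian form** in the basis `u^k_{n,m}`: `⟨v, w⟩ = Σ_t conj(v_t) w_t` (conjugate-linear in
`v`, linear in `w`). [cite: Kovacevic2021, §4 Thm 4] -/
def stdForm : 𝒟.V →ₗ⋆[ℂ] 𝒟.V →ₗ[ℂ] ℂ :=
  LinearMap.mk₂'ₛₗ (starRingEnd ℂ) (RingHom.id ℂ) (fun v w => v.sum fun t a => starRingEnd ℂ a * w t)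
    (fun v₁ v₂ w => by
      rw [Finsupp.sum_add_index']
      · intro _; simp
      · intro _ a b; simp [add_mul])
    (fun c v w => by
      rw [Finsupp.sum_smul_index']
      · simp only [Finsupp.sum, smul_eq_mul, map_mul, Finset.mul_sum, mul_assoc]
      · intro _; simp)
    (fun v w₁ w₂ => by simp only [Finsupp.sum, Finsupp.add_apply, mul_add, Finset.sum_add_distrib])
    (fun c v w => by
      simp only [Finsupp.sum, Finsupp.smul_apply, smul_eq_mul, RingHom.id_apply, Finset.mul_sum, mul_left_comm])

/-- unfolding the standard form [cite: Kovacevic2021, §4 Thm 4] -/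
theorem stdForm_apply (v w : 𝒟.V) : 𝒟.stdForm v w = v.sum fun t a => starRingEnd ℂ a * w t := rfl

/-- `⟨v, v⟩ = Σ_t |v_t|²` is real [cite: Kovacevic2021, §4 Thm 4] -/
theorem stdForm_self (v : 𝒟.V) : 𝒟.stdForm v v = ((v.sum fun _ a => ‖a‖ ^ 2 : ℝ) : ℂ) := by
  rw [stdForm_apply, Finsupp.sum, Finsupp.sum, Complex.ofReal_sum]
  refine Finset.sum_congr rfl fun t _ => ?_
  rw [Complex.conj_mul', Complex.ofReal_pow]

/-- the standard form is positive definite [cite: Kovacevic2021, §4 Thm 4] -/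
theorem stdForm_self_pos {v : 𝒟.V} (hv : v ≠ 0) : 0 < (𝒟.stdForm v v).re := by
  rw [stdForm_self, Complex.ofReal_re, Finsupp.sum]
  obtain ⟨t, ht⟩ := Finsupp.support_nonempty_iff.2 hv
  exact Finset.sum_pos' (fun _ _ => by positivity) ⟨t, ht, by
    have := Finsupp.mem_support_iff.1 ht; positivity⟩

/-- the standard form is Hermitian: `⟨v, w⟩ = conj ⟨w, v⟩` [cite: Kovacevic2021, §4 Thm 4] -/
theorem stdForm_conj_symm (v w : 𝒟.V) : 𝒟.stdForm v w = starRingEnd ℂ (𝒟.stdForm w v) := by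
  rw [stdForm_apply, stdForm_apply, Finsupp.sum, Finsupp.sum, map_sum]
  have h1 : (∑ t ∈ v.support, starRingEnd ℂ (v t) * w t)
      = ∑ t ∈ v.support ∪ w.support, starRingEnd ℂ (v t) * w t :=
    Finset.sum_subset Finset.subset_union_left fun t _ ht => by
      rw [Finsupp.notMem_support_iff.1 ht, map_zero, zero_mul]
  have h2 : (∑ t ∈ w.support, starRingEnd ℂ (starRingEnd ℂ (w t) * v t))
      = ∑ t ∈ v.support ∪ w.support, starRingEnd ℂ (starRingEnd ℂ (w t) * v t) :=
    Finset.sum_subset Finset.subset_union_right fun t _ ht => by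
      rw [Finsupp.notMem_support_iff.1 ht, map_zero, zero_mul, map_zero]
  rw [h1, h2]
  refine Finset.sum_congr rfl fun t _ => ?_
  rw [map_mul, Complex.conj_conj, mul_comm]

/-! ## The trivial module `U(0) = J_{0,0}` -/

/-- **`𝔤𝔩(3,ℂ)` acts by `0` on the trivial module** `U(0) = ℂ u^1_{1,0}` (all eight operators vanish on `u^1_{1,0}`).
[cite: Kovacevic2021, §4 (`U(0)`)] [cite: BorelWallach2000, VI 4.8 (`J_{0,0} = ℂ`)] -/
theorem trivialMod_lie_eq_zero (M : Matrix (Fin 3) (Fin 3) ℂ) (v : trivialMod.V) : ⁅M, v⁆ = 0 := by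
  suffices h : trivialMod.ρfun M = 0 by rw [lie_def, h, LinearMap.zero_apply]
  refine ext_vec fun n m k hS hk hkn => ?_
  have hS' : n = 1 ∧ m = 0 := by simpa [trivialMod] using hS
  obtain ⟨rfl, rfl⟩ := hS'
  obtain rfl : k = 1 := le_antisymm hkn hk
  have hA : ∀ a b : ℤ, trivialMod.A a b = 0 := fun _ _ => rfl
  have hB : ∀ a b : ℤ, trivialMod.B a b = 0 := fun _ _ => rfl
  have hC : ∀ a b : ℤ, trivialMod.C a b = 0 := fun _ _ => rfl
  have hD : ∀ a b : ℤ, trivialMod.D a b = 0 := fun _ _ => rfl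
  have h2 : trivialMod.vec 1 0 2 = 0 := vec_of_lt (𝒟 := trivialMod) (0 : ℤ) (show (1 : ℤ) < 2 by norm_num)
  norm_num [ρfun, hA, hB, hC, hD, h2]

/-- **The trivial module `U(0) = J_{0,0}` is unitarizable** (the standard form; the action is `0`).
[cite: Kovacevic2021, §4 Thm 4] [cite: BorelWallach2000, VI Thm 4.12 (2)] -/
theorem trivialMod_isUnitarizable : IsUnitarizable trivialMod :=
  ⟨trivialMod.stdForm, trivialMod.stdForm_conj_symm, fun _ hv => trivialMod.stdForm_self_pos hv,
    fun i j v w => by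
      rw [trivialMod_lie_eq_zero, trivialMod_lie_eq_zero, map_zero, LinearMap.zero_apply, map_zero, mul_zero]⟩

end SU21Datum

end Literature.RepresentationTheory.Kovacevic2021
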